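import Summits.BirchSwinnertonDyer.Rank1Residual.X9.PrintCertDoors
import Literature.NumberTheory.EllipticCurves.ModThreeImageCubeDiscriminantProofs
import Literature.NumberTheory.EllipticCurves.ModFiveImageSplitCartanJLineProofs
import Literature.NumberTheory.EllipticCurves.ModFiveImageS4JLineProofs
import Literature.NumberTheory.EllipticCurves.ModSevenImageSplitCartanJLineProofs
import HarnessLib

/-!
# Leaves X9 / X10b — the X10b doors of `X9/PrintCertDoors.lean` on a certified record WITHOUT the
# Zywina `j`-line hypotheses (companion; cell `bsd-print-x9`, seat `bsd-print-x9-p1`)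

HONEST FRAMING (D-0131 (2) print tier): theorems only; nothing booked; no leaf closed. The two X10b doors
`Record.bsdp_three_of_check_of_claimLambda_zero/one` of `X9/PrintCertDoors.lean` (seat p3's OFFER doors on
a certified record at `p = 3`) carried the five Zywina `j`-line facts `h3s h3n h5s h5e h7` as hypotheses
for the image certificate. All five are now tree THEOREMS (`…three_of_j_eq_J2/J4_holds`, ARM P;
`…five_of_j_eq_J4/J9_holds`, `…seven_of_j_eq_J2_holds`, this seat: division-polynomial criteria), so the
doors are re-exported here with those binders DISCHARGED. The remaining binders are exactly the doors'
tier: F1 (`hfine`, typed construction fact), the PUBLISHED facts `hGr hS hPR hmodP hGZK h5 h3`, and the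
record's CLAIMS (analytic rank, Iwasawa certificate). [cite: Zywina2015, Thm. 1.2, 1.4, 1.5]
[cite: Kato2004Asterisque, Thm. 17.4]
-/

set_option autoImplicit false

noncomputable section

open scoped Classical MatrixGroups ModularForm

open CongruenceSubgroup WeierstrassCurve Literature.NumberTheory.EllipticCurves
  Literature.NumberTheory.EllipticCurves.ModularForms Literature.NumberTheory.EllipticCurves.Rank1Residual
  Literature.NumberTheory.EllipticCurves.Rank1Residual.Typed
  Literature.NumberTheory.EllipticCurves.Wuthrich2014
  Literature.NumberTheory.EllipticCurves.Kato2004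
  Literature.NumberTheory.EllipticCurves.Rank1Residual.X11RankOneCertificates
  Summit.BirchSwinnertonDyer.BirchSwinnertonDyer.Rank1Residual
  Summit.BirchSwinnertonDyer.BirchSwinnertonDyer.Rank1Residual.IntModel
  Summit.BirchSwinnertonDyer.BirchSwinnertonDyer.Rank1Residual.X11RankOne
  Summit.BirchSwinnertonDyer.BirchSwinnertonDyer.Theorems.Rank1ResidualX1Defs
  Summit.BirchSwinnertonDyer.Rank1Residual

namespace Summit.BirchSwinnertonDyer.Rank1Residual.X9.PrintCert

namespace Record

variable (r : Record) {W : WeierstrassCurve ℚ} [W.IsElliptic] [W.IsGloballyMinimal]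
  (hI : integralModelInt W = r.intCurve)
include hI

/-- **X10b rank-`0` unit cell on a certified record, image certificate IN THE KERNEL**: as
`Record.bsdp_three_of_check_of_claimLambda_zero` with the five Zywina `j`-line facts supplied by their
tree theorems. [cite: Kato2004Asterisque, Thm. 17.4 (p. 273)] [cite: Zywina2015, Thm. 1.2 (second item)] -/
theorem bsdp_three_of_check_of_claimLambda_zero_kernel (hc : r.check = true) (hp3 : r.p = 3)
    (hsome : r.imageCert.isSome = true)
    (hfine : exists_divisibilityInputs_fineQuotient_zeta) (hGr : greenberg_charValue_rankZero)
    (hmodP : nonempty_modularParametrizationData) (hGZK : rank_eq_analyticRank_of_analyticRank_le_one)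
    (h5 : realPeriodRat_eq_unit_mul_plusPeriod) (h3 : realPeriodRat_eq_unit_mul_plusPeriod_three)
    (hrank : r.ClaimRank W) (hl : r.lambdaAn = 0) (hL : r.ClaimLambdaAt W 3) : BSDp W 3 :=
  r.bsdp_three_of_check_of_claimLambda_zero hI hc hp3 hsome
    zywina2015_thm12_not_surjective_three_of_j_eq_J2_holds
    zywina2015_thm12_not_surjective_three_of_j_eq_J4_holds
    zywina2015_thm14_not_surjective_five_of_j_eq_J4_holds
    zywina2015_thm14_not_surjective_five_of_j_eq_J9_holds
    zywina2015_thm15_not_surjective_seven_of_j_eq_J2_holds hfine hGr hmodP hGZK h5 h3 hrank hl hL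

/-- **X10b rank `1` on a certified record, image certificate IN THE KERNEL**: as
`Record.bsdp_three_rankOne_of_check_of_claimLambda_one` with the five Zywina `j`-line facts supplied by
their tree theorems. [cite: Kato2004Asterisque, Thm. 17.4 (p. 273)] [cite: Zywina2015, Thm. 1.2 (second item)] -/
theorem bsdp_three_rankOne_of_check_of_claimLambda_one_kernel (hc : r.check = true) (hp3 : r.p = 3)
    (hsome : r.imageCert.isSome = true)
    (hfine : exists_divisibilityInputs_fineQuotient_zeta) (hS : Schneider1985_order_charGenerator_odd)
    (hPR : perrinRiou_rankOne_leadingTerms_odd) (hmodP : nonempty_modularParametrizationData)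
    (hGZK : rank_eq_analyticRank_of_analyticRank_le_one) (h5 : realPeriodRat_eq_unit_mul_plusPeriod)
    (h3 : realPeriodRat_eq_unit_mul_plusPeriod_three) (hr1 : r.rank = 1) (hrank : r.ClaimRank W)
    (hl : r.lambdaAn = 1) (hL : r.ClaimLambdaAt W 3) : BSDp W 3 :=
  r.bsdp_three_rankOne_of_check_of_claimLambda_one hI hc hp3 hsome
    zywina2015_thm12_not_surjective_three_of_j_eq_J2_holds
    zywina2015_thm12_not_surjective_three_of_j_eq_J4_holds
    zywina2015_thm14_not_surjective_five_of_j_eq_J4_holds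
    zywina2015_thm14_not_surjective_five_of_j_eq_J9_holds
    zywina2015_thm15_not_surjective_seven_of_j_eq_J2_holds hfine hS hPR hmodP hGZK h5 h3 hr1 hrank hl hL

end Record

end Summit.BirchSwinnertonDyer.Rank1Residual.X9.PrintCert

end
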